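import Mathlib
import HarnessLib
import HarnessLib.Audit
import Summits.Parity.Statement
import Literature.NumberTheory.EllipticCurves.Selmer
import HarnessLib.Audit.Status.Attr

/-!
Route: IsogenyRedei

DORMANT since 2026-08-24T18:00:25Z (reconciler: no traction for 6.9 d (last activity item-evidence-added at 2026-08-17T18:31:59Z); parked, not closed — `ledger route dormant route-Parity-IsogenyRedei --off` to reactivate) — unstaffed, not closed; items shared with open routes are served there. `ledger route dormant <id> --off` reactivates.

# Route IsogenyRedei — parity of ω(t²+1) as the Selmer-corank parity of a constant-dual 2-isogenous
pencil; the bounded-cofactor slice wired into the Möbius-tail frame, plus the J_θ probe (rev 5)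

It suffices to show X = X_PM, the MÖBIUS-TAIL frame of route PolynomialMobius, re-wanted verbatim
(target PolyMobiusTail = stmt-Parity-0870; theorem-grade glue TypeIMainTerm 0873, LambdaToCount
0874): for every Bateman–Horn system f there is η ∈ (0,1) with Σ_{n≤x} Σ_{d_i ∣ f_i(n), d₁⋯d_k >
x^{1−η}} ∏ μ(d_i) log d_i = o(x); `closes : PolyMobiusTail → TypeIMainTerm → LambdaToCount →
BatemanHorn` is PROVED (Λ = −(μ·log) ∗ 1 bookkeeping, shared with PolynomialMobius / CyclotomicTower
/ GaussianFractions / CrossedSalie). This route owns ONE slice of X — k = 1, f = X²+1, BOUNDED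
cofactor modulus, the parity slice — and since rev 3 the slice is WIRED INTO THE FRAME by typed
items: SliceFrame : PencilSelmerDictionary → PencilSelmerParitySW → GaussianTailLargeCofactor →
PolyMobiusTailOffGaussian → PolyMobiusTail (theorem-grade glue), where the two remainders
GaussianTailLargeCofactor (the X²+1 tail with large cofactor: level range + window) and
PolyMobiusTailOffGaussian (X_PM for every other system) are named, conjecture-grade and NOT attacked
here. The card's object (isogeny-descent-redei-wall): the 2-isogenous pencil E_t : y² = x((x+t)²+1)
= x³ + 2t x² + (t²+1) x (c₄ = 16(t²−3), c₆ = 64t(t²+9), Δ = −64(t²+1)², kernel ⟨(0,0)⟩, isogenous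
curve y² = x³ − 4t x² − 4x with b′ = a² − 4b = −4 CONSTANT), whose only moving bad fibres are the
primes of t²+1, all split multiplicative (PencilSplitFibres, closed), so that the DICTIONARY holds
EXACTLY: (−1)^{corank_{ℤ₂} Sel_{2^∞}(E_t/ℚ)} = −w(t)·(−1)^{#odd p ∣ t²+1} with w 2^M-periodic (crux
r3 PencilSelmerDictionary; Dokchitser–Dokchitser 2-parity + Cassels' pair of isogeny Selmer sets +
the local analysis; its line toric-node-vacuity-cassels has the local stubs and the glue landed — a
theorem modulo the final assembly). Through the dictionary, ω-PARITY OF t²+1 ALONG PROGRESSIONS WITH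
A SIEGEL–WALFISZ RATE — which is what the log-weighted frame actually consumes on the
bounded-cofactor range (the e = 1 piece alone is Σ_{n≤x} μ(n²+1) = o(x/log x)) — IS EQUIDISTRIBUTION
OF THE SELMER-CORANK PARITY OF E_t IN APs WITH THAT RATE: crux r2 PencilSelmerParitySW (∀A: |Σ_{t≤x,
t≡a (q)} (−1)^{corank}| ≤ Cx/(log x)^A for q ≤ (log x)^A), to be attacked by parity-SENSITIVE Selmer
tools on the pencil (Klagsbrun–Mazur–Rubin disparity on the constant module E_t[2] ≅ Ind_{ℚ(i)}𝔽₂,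
Smith's 2^k-Selmer governing structure, Rédei reciprocity on the explicit isogeny Selmer sets
twoIsogenySelmerGroup (2t) (t²+1), now in Literature). Honest record of what rev 2–3 retired: the
rev-1 ENGINE (Heath-Brown moments Σ_t 2^{k s_φ(t)} ⇒ law ⇒ parity; informal items
SingleBlockMoments, WallLemma, MomentsToParity, dropped) is PARITY-BLIND —
Theorems/MomentsToParity/Negative/ModelParityBlind.lean proves every parity mixture of the model
laws has the same moments — so nothing of the J_θ programme can honestly enter the cone of `closes`,
and its qualitative output QuadraticOmegaParity (support) is in any case one log short of the frame.
PROBE CRUXES (rev 5, judge-repair 2026-08-16; the 06:45Z judge pass: 'the most original idea in the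
file and visibly moving … would move it: a reciprocity/lattice-point argument giving any nontrivial
bound on J_θ for some θ < 1'): the card's atom SplitBlockJacobi (J_θ(x) = Σ_{t≤x} Σ_{Q<Q′∣t²+1,
Q>x^θ} (Q|Q′) = o(x) ∀θ ∈ (1/2,1); crux again, co-rank 2: two line leads, ≈25 landed partial
theorems, survives its kill table to 10⁸) and the NEW typed corner SplitBlockJacobiCorner (rank 4:
∃δ>0 ∀θ>1/2 ∀μ ∈ [1−δ, 2−2θ): the sum over pairs with QQ′ ≤ x^{2−μ} is o(x)) — the judge's ask in
its attackable form. The reciprocity/lattice-point argument EXISTS in the tree up to one estimate: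
pair-side Fubini over the small roots of −1 mod QQ′ (lattice points; stub_pairForm, landed), the
expected part E = 4xΣ(Q|Q′)/(QQ′) = o(x) by quadratic reciprocity (Q|Q′) = χ_Q(Q′) and the
multiplicative large sieve (stub_expectedPart, landed), the small-cofactor peel
(stub_smallCofactorTail, landed), Poisson on the root count (helpers landed) and the corner
implication MixedBilinearBalanced(δ₀) ⇒ TierWeylBound θ μ (μ ≥ 1−δ₀/3, landed) reduce the corner to
ONE bilinear power saving for Σ_{Q,Q′}(Q|Q′)·S(h,QQ′) (Kloosterman-fraction phase e(hν_Q·Q̄′/Q)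
twisted by χ_Q(Q′); DFI 1997 / Heath-Brown 1995 / FI 1998 / Bettin–Chandee territory). These two
cruxes are the route's deliverable on the LAW of the 2-isogeny Selmer rank s_φ(E_t) along the pencil
— informative, staffed, killable — and are deliberately NOT hypotheses of the deciding theorem.
Lean: `∀ (k : ℕ) (f : Fin k → Polynomial ℤ), Literature.NumberTheory.Sieve.IsBatemanHornSystem f → ∃
η : ℝ, 0 < η ∧ η < 1 ∧ (fun x : ℕ => ∑ n ∈ Finset.Icc 1 x, ∑ d ∈ Fintype.piFinset (fun i => (((f
i).eval (n : ℤ)).toNat).divisors), if (x : ℝ) ^ (1 - η) < ∏ i, (d i : ℝ) then ∏ i,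
((ArithmeticFunction.moebius (d i) : ℝ) * Real.log (d i)) else 0) =o[Filter.atTop] fun x : ℕ => (x :
ℝ)`

## Assembly
The deciding theorem is `closes (hTail : PolyMobiusTail) (hMain : TypeIMainTerm) (hCount :
LambdaToCount) : _root_.BatemanHorn` (unchanged since rev 0, native OK): per coordinate ∏ Λ(f_i(n))
= (−1)^k Σ_{d ∈ ∏ divisors(f_i(n))} ∏ μ(d_i) log d_i (ArithmeticFunction.sum_moebius_mul_log_eq,
Finset.prod_neg, Finset.prod_univ_sum), the divisor sum split at ∏ d_i ≤ x^{1−η} (TypeIMainTerm ∼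
C·x) versus x^{1−η} < ∏ d_i (PolyMobiusTail: o(x)), IsEquivalent.add_isLittleO, then LambdaToCount.
Its hypothesis PolyMobiusTail is DERIVED inside the route by the item SliceFrame: SliceFrame hD hS
hL hO : PolyMobiusTail from PencilSelmerDictionary (r3), PencilSelmerParitySW (r2) and the
remainders GaussianTailLargeCofactor, PolyMobiusTailOffGaussian. REWIRE PENDING (rev 5 note): the
slice-shaped deciding theorem `closes (hS : PencilSelmerParitySW) (hD : PencilSelmerDictionary) (hL
: GaussianTailLargeCofactor) (hO : PolyMobiusTailOffGaussian) (hF : SliceFrame) (hMain) (hCount) :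
BatemanHorn` — which takes PolyMobiusTail out of the hypotheses (it clears the judge's dup-crux flag
with PolynomialMobius and puts r2/r3 into the cone) — is STAGED (route evidence closes7.lean by the
unused-crux repair planner: one theorem `closes`, 7 binders, native preview ok; an equivalent
glue.lean previewed ok in the judge-repair planner's folder), but installing it changes the
signature of `closes`, which Theorems/IsogenyRedeiAssembly.lean applies with three arguments
(isogenyRedei_assembly_proof), and a closes file may hold one theorem only; so the rewire waits for
a prover to LAND the migrated, closes-independent Assembly proof (IsogenyRedeiAssembly.migrated.lean
attached to stmt-Parity-11589, lean check rc 0), after which `ledger route edit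
route-Parity-IsogenyRedei --closes-file closes7.lean` lands it (both remainders are already
crux-kinded, so no conjecture-grade hypothesis of the new `closes` will be a non-crux). Open leaves
of the intended cone: PencilSelmerParitySW (this route's research crux), the two remainders (other
routes' business), SliceFrame (XL glue, provable), TypeIMainTerm / LambdaToCount (theorem-grade,
shared; needs_repair glue.non-crux-hypothesis is summit-wide and closes when they are proved),
PencilSelmerDictionary (closing). Import cone unchanged:
Literature.NumberTheory.EllipticCurves.Selmer (WeierstrassCurve.selmerCorank); no unproved
Literature fact is a hypothesis of any item.

Rationale: WHY THIS LINE. Helfgott (Helfgott2003RootNumbers; Helfgott2004RootNumberFamilies =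
arXiv:math/0408141, Prop. 5.4 / Thm 7.1) writes W(𝓔(t)) = g·h·λ(M_𝓔(t)) and feeds Chowla INTO
root-number averages; this route runs the dictionary in reverse on the pencil chosen by the card
isogeny-descent-redei-wall — 2-ISOGENOUS WITH A CONSTANT DUAL LOCUS (b′ = −4) — so that the
dictionary is EXACT up to a periodic sign (PencilSelmerDictionary: DokchitserDokchitserAnnals2010
Thm 1.4 + Cassels' pair, SilvermanAEC2009 X.4.9 + the local analysis PencilSplitFibres, closed) and
the parity-carrying object is an explicit finite 𝔽₂-space (twoIsogenySelmerGroup, landed in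
Literature on this route's request). Imported area: arithmetic statistics of Selmer groups in
families — with two corrections recorded in rev 2–3. (a) The MOMENT engine of rev 1
(HeathBrown1994SelmerCongruentII, Kane2013SelmerTwists, PoonenRains2012) is parity-blind:
Theorems/MomentsToParity/Negative/ModelParityBlind.lean (heathBrownLaw_parityBlind) — Heath-Brown
gets the law from the moments only WITH the parity as input — so the usable imports are the
parity-SENSITIVE ones: Klagsbrun–Mazur–Rubin disparity (KlagsbrunMazurRubin2013; E_t[2] ≅
Ind_{ℚ(i)}𝔽₂ is constant along the pencil), Smith's governing structure for 2^∞-Selmer groups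
(Smith2017SelmerGoldfeld), Rédei reciprocity on the explicit Selmer sets. (b) The frame is
log-weighted: what `closes` consumes on the bounded-cofactor range is parity with a (log x)^{−A}
saving along APs of modulus ≤ (log x)^A (Siegel–Walfisz shape), not o(x); the research crux is
re-cut accordingly (PencilSelmerParitySW) and wired to PolyMobiusTail by the typed glue SliceFrame
with two named remainders. What the line adds to SelmerPencil (universal pencil j = 1728 + 1/F, full
Sel₂, EH-level crux SelmerParityLevel) and PolynomialMobius: the weakest parity input that honestly
feeds the frame (bounded cofactor, SW rate), isolated on the one pencil where the Selmer side is
explicit and the dictionary is a theorem.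
RANKED CRUXES. #0 PolyMobiusTail (target, auto-crux) — X_PM of route PolynomialMobius
(stmt-Parity-0870), the frame; with TypeIMainTerm and LambdaToCount it gives BatemanHorn (`closes`);
derived inside the route by the item SliceFrame from r2, r3 and the two remainders; leaves the
hypotheses of `closes` when the pending rewire lands (why it might fail: = BatemanHorn in Λ-form
modulo theorem-grade glue; false iff BH fails for some system — verbatim so over 𝔽_q[u] for
inseparable f). [BombieriAsymptoticSieve1976, arXiv:2008.09905, ConradConradGross2008] #2
PencilSelmerParitySW (crux, LOAD-BEARING) — ∀A ∃C, x₀ ∀x ≥ x₀ ∀q ≤ (log x)^A ∀a: |Σ_{t≤x, t≡a (q)}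
(−1)^{corank Sel_{2^∞}(E_t)}| ≤ Cx/(log x)^A; by r3 equivalent to ω-parity of t²+1 in APs with a
Siegel–Walfisz rate; SliceFrame consumes A = 8 (why it might fail: it is polynomial Chowla for n²+1
with a rate — open; every Selmer-parity law in print reads parity from root numbers, circular here;
moments are parity-blind; KMR/Smith count over boxes of twists, and a thin one-parameter family may
be out of their reach). [KlagsbrunMazurRubin2013, Smith2017SelmerGoldfeld, Teravainen2024,
DokchitserDokchitserAnnals2010, HeathBrown1994SelmerCongruentII] #2 SplitBlockJacobi (crux again
since rev 5 — PROBE, co-rank 2 because that is where the route's two line leads and ≈25 landed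
partials are; the judge's named item) — ∀θ ∈ (1/2,1): J_θ(x) = Σ_{t≤x} Σ_{Q<Q′ primes ∣ t²+1, Q >
x^θ} (Q|Q′) = o(x). State of the attack (line cofactor-root-discrepancy,
Cruxes/SplitBlockJacobi/Lines): J = E + D^bulk(μ) + D^tail(μ) on the pair side (small roots of −1
mod QQ′ = lattice points); stub_pairForm, stub_expectedPart (E = o(x): reciprocity (Q|Q′) = χ_Q(Q′)
+ multiplicative large sieve) and stub_smallCofactorTail are LANDED, stub_poissonReduction
(TierWeylBound θ μ ⇒ D^bulk = o(x)) is true bookkeeping with most helpers landed, and everything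
rests on TierWeylBound: a saving N^{(1−μ)/(2−μ)+} for the twisted root Weyl sums T_h =
Σ_{Q,Q′}(Q|Q′)S(h,QQ′) in cofactor tier μ (why it might fail: below μ = 2/3 coefficient-blind
bilinear methods cap at N^{1/4} (cut-norm ≥ (nn′)^{3/4}) while the needed saving tends to
√N·x^{−μ/2} as μ → 0 — GRH-strength cancellation for an arithmetic bilinear form with no engine in
print; a secondary term at structured h would bias it). [doi:10.1007/s002220050135,
doi:10.4064/aa-72-3-235-275, arXiv:math/9811185, doi:10.1016/j.aim.2018.01.026, doi:10.2307/2118527,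
HeathBrown1994SelmerCongruentII] #3 PencilSelmerDictionary (crux, closing) — ∃M, w 2^M-periodic:
(−1)^{corank Sel_{2^∞}(E_t)} = −w(t)(−1)^{#odd p∣t²+1} for t ≥ 1 (theorem in print; line
toric-node-vacuity-cassels: local stubs A–E and glue landed, final assembly pending) (why it might
fail: only if the final assembly slips). [DokchitserDokchitserAnnals2010, Monsky1996,
SilvermanAEC2009, Helfgott2004RootNumberFamilies] #4 SplitBlockJacobiCorner (crux, NEW in rev 5 —
the judge's 'any nontrivial bound on J_θ for some θ < 1', typed) — ∃δ > 0 ∀θ > 1/2 ∀μ ∈ [1−δ, 2−2θ):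
Σ_{t≤x} Σ_{Q<Q′ primes ∣ t²+1, Q > x^θ, QQ′ ≤ x^{2−μ}} (Q|Q′) = o(x): the near-balanced corner of
J_θ (θ < (1+δ)/2, large cofactor), where the LANDED corner implication
tierWeylBound_of_mixedBilinearBalanced makes it follow (δ = δ₀/3, plus the landed/landable stubs 1–4
of the line) from ONE bilinear estimate MixedBilinearBalanced(δ₀): ‖Σ_{Q~P₁}Σ_{Q′~P₂}(Q|Q′)S(h,QQ′)‖
≤ (P₁P₂)^{1−δ₀} for primes ≡ 1 (4), P₂ ≤ 8P₁^{1+δ₀}, 0 < |h| ≤ (P₁P₂)^{δ₀} — ANY power saving; the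
corner's mass is O(x) (stub_splitMassBound) and conjecturally ≍ c·x, so o(x) is a genuinely
nontrivial bound on a positive-proportion piece of J_θ (why it might fail: by CRT S(h,QQ′) =
S(hQ̄′,Q)S(hQ̄,Q′) the kernel is a Kloosterman FRACTION e(hν_Q·Q̄′/Q) whose numerator moves with Q,
twisted by χ_Q(Q′): DFI 1997 bounds e(a·m̄/n) for fixed a and Heath-Brown's quadratic large sieve
handles χ alone — the mixed kernel is open; a secondary term at structured h of relative size >
N^{−δ₀} kills it). [doi:10.1007/s002220050135, doi:10.4064/aa-72-3-235-275, arXiv:math/9811185,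
doi:10.1016/j.aim.2018.01.026, doi:10.2307/2118527, doi:10.1093/imrn/rnr112] #9
GaussianTailLargeCofactor (auto-crux, remainder, conjecture-grade, not attacked: the X²+1 tail with
cofactor > E(ε) is ≤ εx — level range + window, GaussianFractions / SelmerPencil territory). #9
PolyMobiusTailOffGaussian (crux, remainder, conjecture-grade, not attacked: X_PM verbatim for every
system (k, f) ≠ (1, X²+1) — BatemanHorn in Λ-form off the Gaussian system; why it might fail: iff BH
fails for some non-Gaussian system, as the inseparable 𝔽_q[u]-analogues do). SUPPORT (rank 9):
SliceFrame (glue, theorem-grade XL: r3 → r2 → GaussianTailLargeCofactor → PolyMobiusTailOffGaussian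
→ PolyMobiusTail; parity transfer + squarefree sieve with rates and a Pell tail, partial summation,
Fin-1 link, case split); TypeIMainTerm, LambdaToCount (shared theorem-grade frame glue);
PencilInvariants, PencilSplitFibres, OmegaToMobiusAP, Assembly (CLOSED, proved);
QuadraticOmegaParity (qualitative ω-parity of quadratics in APs, o(x): one log short of the frame,
evidence-only). The two J_θ cruxes are PROBES: not hypotheses of `closes` (parity-blind,
ModelParityBlind) — their deliverable is the law of the 2-isogeny Selmer rank along a thin
polynomial pencil, new arithmetic statistics in its own right; a future unused-crux pass should
leave them crux (judge mandate 2026-08-16) unless a judge pass says otherwise.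
TWO-LAYER PLAN. Foreseen glued splits (none filed now; k ≤ 3, depth 1). PencilSelmerParitySW ⇐
[DisparityOnPencil: a Klagsbrun–Mazur–Rubin-type statement that along t in an AP the Selmer-corank
parity of E_t is governed by an explicit local datum at 2 and ∞ only, with an effective error] →
[LocalDatumEquidistribution: that datum equidistributes in APs with a (log x)^{−A} saving — a 2-adic
/ digit statement about t, plausibly elementary] → PencilSelmerParitySW; the honest risk is that the
first child is false or empty for a thin family (KMR's disparity constant is a density over all
twists, not along a polynomial pencil). SliceFrame ⇐ (i) ParityToCofactorMobius: r3 → r2 → ∀e: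
Σ_{n≤y, e∣n²+1} μ((n²+1)/e) ≪_e y/(log y)² → (ii) CofactorToSlice: that → GaussianTailLargeCofactor
→ GaussianFractions.QuadraticMobiusTail (stmt-Parity-13616) → (iii) QuadraticFrameLink
(stmt-Parity-13634) + the proved case split; provers may equally land (i)–(iii) as helpers with
--supports instead of a split. SplitBlockJacobiCorner ⇐ no split foreseen: its line is the corner of
cofactor-root-discrepancy — (a) MixedBilinearBalanced(δ₀) (the one open estimate; registered stub
vocabulary in Theorems/IsogenyRedeiSplitBlockJacobiWeylDefs.lean), (b) the corner versions of
stub_pairForm / stub_expectedPart (cut at QQ′ ≤ x^{2−μ} instead of x²+1: same proofs), (c)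
stub_poissonReduction at the corner tier; a lead lands (b), (c) with --supports and holds (a).
KILL CRITERIA. PencilSelmerParitySW refuted INSIDE the range SliceFrame consumes (some A ≤ 8, q ≤
(log x)^8: a (log x)^{−A}-bias of the Selmer/ω-parity of t²+1 along a progression — a CCG-type
phenomenon over ℤ) ⇒ by r3 ¬(ω-parity with rate) for n²+1 ⇒ the bounded-cofactor input of EVERY X²+1
route fails ⇒ close `refuted:PencilSelmerParitySW` and flag Conjecture E summit-wide; refuted only
for larger A or wider q ⇒ class misstated, restate at the consumed range. PencilSelmerDictionary
contradicted (root numbers not of the form −w(t mod 2^M)(−1)^{ω_odd}) ⇒ re-derive the 2-adic factor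
and restate (pivot, same frame) — moot once its line closes. GaussianTailLargeCofactor or
PolyMobiusTailOffGaussian refuted ⇒ BH itself fails (for n²+1 resp. another system): the frame dies
for every route, not a pivot of this one. A grounder's proof that every parity-sensitive Selmer tool
needs the root number as INPUT on this pencil (circularity made precise) empties r2's programme ⇒
route dormant / exhausted, nothing refuted. PolyMobiusTail proved elsewhere ⇒ BatemanHorn by
`closes`, route moot. J_θ probes (do NOT close or pivot the route — they are outside the cone):
SplitBlockJacobiCorner refuted (a bias ≫ mass in the near-balanced corner, or MixedBilinearBalanced
false at every δ₀ through a structured-h secondary term) ⇒ drop the corner, record the obstruction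
as a barrier note (bilinear Kloosterman-fraction × real-character kernels), keep SplitBlockJacobi
only if the h-summed discrepancy form survives; SplitBlockJacobi refuted at some θ (drift in the
kill table: |J_θ| ≥ c·x at 10⁸–10⁹) ⇒ drop both probes, the card's atom is dead, the parity slice is
unaffected.
NOT DECOMPOSED YET. The KMR / Smith line on r2 (above) until a crux-ideate round on
PencilSelmerParitySW proposes typed children; uniformity beyond (log x)^A moduli (level aspects live
in SelmerPencil r3 and GaussianFractions); the other shape classes of the card (cubic pencil C_t :
y² + 3txy + (t³+2)y = x³ with its 3-isogeny, X⁴+1, Φ₈, Φ₁₂, full-2-torsion pencils for linear pairs)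
— each its own slice with its own dictionary and the same two remainders mutatis mutandis; the
function-field test-bed (the same pencil over 𝔽_q[u]: Swan's discriminant character vs Selmer
parity); the deep tiers μ < 2/3 of SplitBlockJacobi (stub_weylDeep: no engine; round-2 ideation must
name the arithmetic feature of the prime coefficients it exploits); whether J_θ-type cancellation
has any parity-SENSITIVE use (none known: s_φ − s_φ′ is the additive Tamagawa exponent, so the
parity of s₂ is ω(t²+1) again). PENDING STRUCTURAL REPAIR (staged, blocked on one prover landing):
rewire `closes` through SliceFrame — staged as route evidence closes7.lean (7 binders, native
preview ok) — as soon as a prover lands the closes-independent Assembly proof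
IsogenyRedeiAssembly.migrated.lean (attached to stmt-Parity-11589; the current
Theorems/IsogenyRedeiAssembly.lean applies `closes hTail hMain hCount` and would break); then
`ledger route edit route-Parity-IsogenyRedei --closes-file closes7.lean`; this clears
dup-crux:route-Parity-PolynomialMobius and all of glue.unused-crux except the two J_θ probes
(intended).
CHEAPEST FALSIFIER. (i) kit, minutes: by root-sieve factorisation of t²+1 (or PARI ellrootno =
(−1)^{corank} by DD p-parity) tabulate S(x; q, a) = Σ_{t≤x, t≡a (q)} (−1)^{ω(t²+1)} for x ≤ 10⁸, q ∈
{1, …, 64} ∪ {2^j}, all a: r2 predicts |S| ≲ few·√(x/q) and NO drift of size x/(q (log x)^c) (≈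
x/(340 q) at 10⁸ for c = 2 would be plainly visible); such a drift kills r2 as typed (refuter AP
tables at 2·10⁶ for 8 quadratics: square-root size). (ii) Lookup: a KMR/Smith-type
parity-equidistribution theorem ALONG A ONE-PARAMETER POLYNOMIAL FAMILY (not over boxes of twists)
in print would make r2's programme concrete — a published obstruction would empty it. (iii) Lean,
done: the frame case split and closes-via-slice (Sketch.lean, rc 0; glue.lean previewed natively
2026-08-16). (iv) J_θ corner, kit minutes (deep_box_Th.py on the crux item): T_h/(P₁P₂) in
near-balanced boxes (P₁,P₂) = (x^{.51}, x^{.55}), x = 10⁸…10¹⁰, h ≤ 10³ incl. structured h = □, h =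
Q-multiples: a plateau |T_h| ≥ c·P₁P₂ at some structured h kills MixedBilinearBalanced (so far
|T_h|/√N ≤ 5.1 in every box measured, j008654/j008680 + deep_box tables); (v) lookup: a bilinear
bound for Σ α_m β_n χ_n(m) e(a_m·m̄/n) (real character × Kloosterman fraction with moving numerator)
in print makes the corner a short paper.
NUMBERS. E_t: b₂ = 8t, b₄ = 2(t²+1), b₆ = 0, b₈ = −(t²+1)², c₄ = 16(t²−3), c₆ = 64t(t²+9), Δ =
−64(t²+1)², j = −64(t²−3)³/(t²+1)²; 2-isogenous curve y² = x³ − 4t x² − 4x (b′ = −4); v₂(Δ) = 6 (t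
even), 8 (t odd); s_φ(t) = twoIsogenySelmerRank (2t) (t²+1) ≤ ω(t²+1) + 2. Rate bookkeeping of
SliceFrame: e = 1 piece ⟺ Σ_{n≤x} μ(n²+1) = o(x/log x); squarefree sieve with R = (log y)³ and Pell
tail O(y^{2δ} log y) needs the parity bound at A = 8 for moduli ≤ (log y)^7·2^{M+1}; expected size
of S(x; q, a): O((x/q)^{1/2+ε}) (no secondary main term: z = −1 is an integer exponent in
Selberg–Delange, 1/Γ(−1) = 0). Rev-1 measurements kept for the record: J_θ/√N_θ ∈ [0.46, 1.88] at
10⁶ (θ = 0.6 … 0.9), no drift to 10⁸ (refuter kit j014067); dominant-free density 0.321 at 10⁶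
(Dickman 1 − log 2 = 0.307). Items after rev 5: 15 (auto-crux target PolyMobiusTail; cruxes
PencilSelmerParitySW, SplitBlockJacobi, PencilSelmerDictionary, SplitBlockJacobiCorner,
GaussianTailLargeCofactor (auto), PolyMobiusTailOffGaussian; 7 supports of which 3 closed; the
closed assembly) — at the 15-item cap: the next addition must drop QuadraticOmegaParity
(evidence-only) first. Corner bookkeeping: MixedBilinearBalanced(δ₀) ⇒ TierWeylBound θ μ for 1 −
δ₀/3 ≤ μ < 1 with ε₀ = δ₀/3 (landed), so SplitBlockJacobiCorner holds with δ = δ₀/3; corner mass ≤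
N_θ(x) ≤ 60(1−θ)/(2θ−1)·x (landed); measured N_θ/x = 0.215 (θ = 0.6) … 0.0086 (θ = 0.9).
DEFINITION REQUESTS. None open: twoIsogenySelmerGroup / twoIsogenySelmerRank
(Literature/NumberTheory/EllipticCurves/TwoIsogenySelmerGroup.lean) landed on rev 1's request;
cassels_selmerCorank_two_parity is the named fact r3's line uses. Wanted eventually with `_holds`
(hypotheses of no item): Literature.NumberTheory.EllipticCurves.p_parity (DD2010 Thm 1.4),
Helfgott2004RootNumberFamilies Prop. 4.2 local constancy.

Novelty: Searches (2026-08-15, this seat): `lit galaxy search "Selmer groups for the congruent number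
problem" --star all` (12 rows: HB-adjacent
non-congruent-number papers, Fouvry–Klüners 4-rank Spiegelungssatz, Wang–Zhang full-2-torsion twists
— no pencil); `lit galaxy search
--star pdf --mode bm25 "distribution of Selmer ranks and root numbers … one-parameter polynomial
family, parity of number of prime
factors of t^2+1, Rédei matrix"` (15 rows, none relevant: OWR 2024/40, Lozano-Robledo rank model,
Magma notes); `lit galaxy search
"2-isogeny Selmer" --star pdf` (2, Magma); `lit galaxy search "root number Liouville function"
--star all` (0); `lit search` (local +
OpenAlex/S2/arXiv cascade) for "2-isogeny Selmer group one-parameter family … Rédei matrix" and "…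
root number Liouville polynomial"
returned rc 75 (searchd unavailable) twice this session — auditor please rerun, in particular
'Selmer ranks family y²=(x−t)(x²+1)',
'2-isogeny Selmer Rédei matrix one-parameter family', 'Tamagawa ratio two-torsion family Klagsbrun
Lemke Oliver'. Card-level searches
(ideate seat 33-0 and triage 23-0, same day) covered all 136 BatemanHorn cards, `lit frontier Parity
--since 2022`, `lit bridges Parity
--cross any`, hybrid/arXiv searches for Helfgott-type root-number families and
Heath-Brown/Kane/Smith moments.
Nearest prior art found: arXiv:math/0408141 (Helfgott: W(𝓔(t)) = g·h·λ(M_𝓔(t)), forward direction;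
here M = t²+1 with g periodic);
doi:10.1007/BF01231285 + doi:10.1007/BF01231536 (Heath-Br  [refs: 10.1007/BF01231285, 10.1007/BF01231536, math/0408141, 1009.1365, 1702.02325, doi:10.1007/BF01231285, doi:10.1007/BF01231536, DokchitserDokchitserAnnals2010]

Barriers (technique_class: isogeny-descent, selmer-parity, squarefree-sieve): - technique_class: isogeny-descent, selmer-parity, squarefree-sieve
- Literature.Barriers.Parity.SelbergParityBarrier: NOT evaded and carried openly — crux r2
PencilSelmerParitySW is, through the dictionary r3, exactly the parity statement for n²+1 (ω-parity
in APs) with the (log x)^{−A} saving the log-weighted frame consumes; the route's only move against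
the barrier is a change of currency (Selmer-corank parity of an explicit constant-dual pencil, where
parity-SENSITIVE non-sieve tools exist: Klagsbrun–Mazur–Rubin disparity on the constant module
E_t[2], Smith's 2^k-Selmer governing structure, Rédei reciprocity on twoIsogenySelmerGroup (2t)
(t²+1)); the bet is that one of them reaches a thin one-parameter family with a power-of-log saving.
The rev-1 moment engine is retired as parity-blind
(Theorems/MomentsToParity/Negative/ModelParityBlind.lean) — a barrier in its own right for every
"moments ⇒ parity" line.
- Literature.Barriers.Parity.FordMaynardLowLevel: conceded and LOCATED, not attacked — the thin-set
regime (c = 1/2 for n²+1, no Type-II range) is the remainder item GaussianTailLargeCofactor (level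
range + balanced window of the X²+1 tail), left to GaussianFractions / SelmerPencil /
PolynomialMobius.
- Literature.Barriers.Parity.FordMaynardMinimalTypeII: same concession — no Type-II information is
claimed anywhere; the glue SliceFrame is elementary (parity transfer, three-range squarefree sieve
with a Pell tail, partial summation, Fin-1 bookkeeping) and takes the pari

History (route lifecycle, newest last):
- 2026-08-16T04:13:32Z · AUTO-CRUX (backfill): PolyMobiusTail — hypotheses of the deciding theorem that nothing in the route derives are cruxes (operator:999:1085951)
- 2026-08-16T06:51:36Z · rev 3: dropped stmt-Parity-11609, stmt-Parity-11618, stmt-Parity-11620 — route-repair (unused-crux) step 2a/2: drop the three INFORMAL moment-engine items SingleBlockMoments (11609), WallLemma (11618), MomentsToParity (11620) — the r (planner-rrepair-Parity-IsogenyRedei-unused-5f66c0fc-0)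
- 2026-08-24T18:00:25Z · DORMANT — reconciler: no traction for 6.9 d (last activity item-evidence-added at 2026-08-17T18:31:59Z); parked, not closed — `ledger route dormant route-Parity-IsogenyRe (operator:999:978961)

sub-problem: BatemanHorn · status: dormant · opened planner-plancard-Parity-BatemanHorn-isogeny-d-04137cff-0 2026-08-15T18:25:26Z · rev 9 · ledger route-Parity-IsogenyRedei
GENERATED by the gate from the ledger (D-0016/17). Provers cite these decls: `theorem foo : Summit.Parity.BatemanHorn.Theses.IsogenyRedei.<Decl> := …` in Summits/Parity/BatemanHorn/Theorems/<Name>.lean.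
-/

namespace Summit.Parity.BatemanHorn.Theses.IsogenyRedei

open scoped BigOperators Topology Manifold Classical MeasureTheory ProbabilityTheory Matrix InnerProductSpace ComplexConjugate ContinuousMap
open Filter Set Function TopologicalSpace MeasureTheory

attribute [summit_statement] _root_.BatemanHorn

/-- item stmt-Parity-0870 · crux (kind.auto-crux: conjecture-grade) · rank 0 · open · by planner
why it might fail: = BatemanHorn in Λ-form modulo theorem-grade glue (Bombieri's indeterminacy: no Type-I level < 1 decides it); false iff BH fails for some system — verbatim so over 𝔽_q[u] for inseparable f (Conrad–Conrad–Gross).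
sources: BombieriAsymptoticSieve1976, arXiv:2008.09905, ConradConradGross2008, Literature.Barriers.Parity.FunctionFieldMobiusBias
[crux] X_PM, the Möbius tail: for every Bateman–Horn system f = (f_1..f_k) there is η ∈ (0,1) with
∑_{n≤x} ∑_{d_i | f_i(n), d_1⋯d_k > x^{1−η}} ∏_i μ(d_i) log d_i = o(x). Since ∏Λ(f_i(n)) = (−1)^k
∑_{d_i|f_i(n)} ∏ μ(d_i) log d_i and the complementary range d_1⋯d_k ≤ x^{1−η} is Type-I
(TypeIMainTerm), this is BatemanHorn minus theorem-grade glue. k = 1 reading: Möbius randomness of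
the large cofactor f(n)/e along the roots of f mod e, e ≤ x^{deg f − 1 + η}. Open (parity). Sources:
BombieriAsymptoticSieve1976 (indeterminacy), Entin2016 / SawinShusterman2018 (F_q[T] analogues are
theorems), BrowningSofosTeravainen2022 (true for 100% of f). -/
@[route_item "route-Parity-IsogenyRedei", crux]
def PolyMobiusTail : Prop :=
  ∀ (k : ℕ) (f : Fin k → Polynomial ℤ), Literature.NumberTheory.Sieve.IsBatemanHornSystem f → ∃ η : ℝ, 0 < η ∧ η < 1 ∧ (fun x : ℕ => ∑ n ∈ Finset.Icc 1 x, ∑ d ∈ Fintype.piFinset (fun i => (((f i).eval (n : ℤ)).toNat).divisors), if (x : ℝ) ^ (1 - η) < ∏ i, (d i : ℝ) then ∏ i, ((ArithmeticFunction.moebius (d i) : ℝ) * Real.log (d i)) else 0) =o[Filter.atTop] fun x : ℕ => (x : ℝ)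

/-- item stmt-Parity-11583 · crux · rank 2 · open · by planner
why it might fail: Reduced (pair form, E = o(x), small-cofactor tail LANDED) to TierWeylBound in every cofactor tier μ; below μ = 2/3 coefficient-blind bilinear methods cap at N^{1/4} (cut norm) while N^{(1−μ)/(2−μ)} → √N is needed as μ → 0: GRH-strength cancellation, no engine in print; structured-h bias possible.
sources: doi:10.1007/BF01231285, doi:10.1007/BF01231536, doi:10.1007/s002220050135, doi:10.4064/aa-72-3-235-275, arXiv:math/9811185, doi:10.1016/j.aim.2018.01.026
[crux] the card's NEW ATOM (K1, first instance, weights r_k ≡ 1): for every θ ∈ (1/2, 1), J_θ(x) :=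
Σ_{t≤x} Σ_{Q<Q′ primes, Q > x^θ, Q·Q′ ∣ t²+1} (Q|Q′) = o(x). Both Q, Q′ ≡ 1 (mod 4), so (Q|Q′) =
(Q′|Q) is one well-defined sign per value; QQ′ > x^{2θ} > x leaves at most three such pairs per t,
and the trivial mass #{(t,Q,Q′)} is ≍_θ x (measured 0.21x at θ = 0.6, 0.0086x at θ = 0.9, x = 10⁶).
For θ > 1 − ε these are exactly the split-block terms of the linked-index expansion of every moment
Σ_t 2^{k s_φ(E_t)} (two non-enumerable primes in different classes); for smaller θ the statement
also contains single-block configurations that SingleBlockMoments-technology should evaluate to o(x)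
((Q′|Q) = χ_Q(cofactor) of Burgess length x/Q in a root class). [difficulty: open-problem] -/
@[route_item "route-Parity-IsogenyRedei"]
def SplitBlockJacobi : Prop :=
  ∀ θ : ℝ, 1 / 2 < θ → θ < 1 → (fun x : ℕ => ∑ t ∈ Finset.Icc 1 x, ∑ q ∈ ((t ^ 2 + 1).primeFactors ×ˢ (t ^ 2 + 1).primeFactors).filter (fun q : ℕ × ℕ => (x : ℝ) ^ θ < (q.1 : ℝ) ∧ q.1 < q.2), (jacobiSym (q.1 : ℤ) q.2 : ℝ)) =o[Filter.atTop] fun x : ℕ => (x : ℝ)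

/-- item stmt-Parity-14950 · crux · rank 2 · open · by planner
why it might fail: Through the dictionary it IS ω-parity of n²+1 in APs with a (log x)^-A saving — polynomial Chowla with rate, open; Selmer-parity laws in print read parity FROM root numbers (circular here), moments are parity-blind (ModelParityBlind), KMR/Smith count over twist boxes, not pencils.
sources: KlagsbrunMazurRubin2013, Smith2017SelmerGoldfeld, HeathBrown1994SelmerCongruentII, PoonenRains2012, DokchitserDokchitserAnnals2010, Teravainen2024
[crux] THE DELIVERABLE WITH THE RATE THE FRAME NEEDS (rev 3, route-repair 2026-08-16; replaces the
qualitative QuadraticOmegaParity as the load-bearing parity statement): Siegel–Walfisz-shape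
equidistribution of the 2^∞-Selmer corank parity of the pencil E_t = ⟨0, 2t, 0, t²+1, 0⟩ along
arithmetic progressions — for every A > 0 there are C, x₀ with |Σ_{t ≤ x, t ≡ a (q)}
(−1)^{corank_{ℤ₂} Sel_{2^∞}(E_t/ℚ)}| ≤ C·x/(log x)^A for all x ≥ x₀, 1 ≤ q ≤ (log x)^A, all a. By
PencilSelmerDictionary ((−1)^{corank} = −w(t)(−1)^{ω_odd(t²+1)}, w = ±1 and 2^M-periodic) it is
EQUIVALENT, class by class mod lcm(q, 2^{M+1}), to the same bound for (−1)^{ω(t²+1)}: ω-parity of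
n²+1 in APs with a Siegel–Walfisz rate. Why the rate: the Λ-weighted frame X_PM carries a log-weight
— already the e = 1 piece of the X²+1 tail, Σ_{n≤x} μ(n²+1) log(n²+1) = o(x), is equivalent by
partial summation to Σ_{n≤x} μ(n²+1) = o(x/log x) — so an o(x) parity statement
(QuadraticOmegaParity, SplitBlockJacobi, SelmerPencil.SelmerParityAtom) can never feed `closes`.
SliceFrame consumes this crux at ONE fixed exponent (A = 8: squarefree-sieve moduli
e·rad(e)·r²·2^{M+1} with r ≤ (log x)³); 'for all A' is the natural shape and th -/
@[route_item "route-Parity-IsogenyRedei"]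
def PencilSelmerParitySW : Prop :=
  ∀ A : ℝ, 0 < A → ∃ C : ℝ, ∃ x₀ : ℕ, ∀ x : ℕ, x₀ ≤ x → ∀ q : ℕ, 1 ≤ q → (q : ℝ) ≤ Real.log x ^ A → ∀ a : ℕ, |∑ t ∈ (Finset.Icc 1 x).filter (fun t : ℕ => t ≡ a [MOD q]), (-1 : ℝ) ^ (WeierstrassCurve.selmerCorank (⟨0, 2 * (t : ℚ), 0, (t : ℚ) ^ 2 + 1, 0⟩ : WeierstrassCurve ℚ) 2)| ≤ C * (x : ℝ) / Real.log x ^ A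

/-- item stmt-Parity-11584 · crux · rank 3 · open · by planner
why it might fail: Theorem in print (DD2010 Thm 1.4 + Cassels X.4.9 pair + local analysis) and its line toric-node-vacuity-cassels has stubs A–E and the glue LANDED (p82088 p83097 p82496 p82720 p83775 p83779; E = p84946 pending): fails only if the final assembly slips.
sources: DokchitserDokchitserAnnals2010, Monsky1996, SilvermanAEC2009, Helfgott2004RootNumberFamilies, Rohrlich1993Compositio, Literature.NumberTheory.EllipticCurves.cassels_selmerCorank_two_parity
[crux] the pencil carries the parity of ω(t²+1) EXACTLY (card P1 read through 2-parity): there are M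
and a 2^M-periodic w : ℕ → ℤ with (−1)^{corank_{ℤ₂} Sel_{2^∞}(E_t/ℚ)} = −w(t)·(−1)^{#{odd primes p ∣
t²+1}} for all t ≥ 1, E_t = ⟨0, 2t, 0, t²+1, 0⟩. In print: (−1)^{corank} = W(E_t)
(Dokchitser–Dokchitser 2010 Thm 1.4; Monsky 1996 for p = 2), W = ∏_v W_v, W_∞ = −1, W_p = −1 at the
split multiplicative odd p ∣ t²+1 (v_p(c₄) = 0 as t² − 3 ≡ −4; tangent slopes² = 2t, (2t|p) = +1),
W_p = +1 at odd p ∤ t²+1 (v_p(Δ) = 0), and t ↦ W₂(E_t) locally constant on ℤ₂ (v₂(Δ) ∈ {6, 8}, no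
2-adic singular fibre: Helfgott's local constancy / Kisin), hence periodic modulo a fixed 2^M by
compactness. Typed over WeierstrassCurve.selmerCorank + Mathlib only (no root-number vocabulary in
the cone, as in SelmerPencil rev 1). [difficulty: XL] -/
@[route_item "route-Parity-IsogenyRedei"]
def PencilSelmerDictionary : Prop :=
  ∃ M : ℕ, ∃ w : ℕ → ℤ, (∀ t : ℕ, w (t + 2 ^ M) = w t) ∧ ∀ t : ℕ, 1 ≤ t → (-1 : ℤ) ^ (WeierstrassCurve.selmerCorank (⟨0, 2 * (t : ℚ), 0, (t : ℚ) ^ 2 + 1, 0⟩ : WeierstrassCurve ℚ) 2) = -(w t * (-1 : ℤ) ^ (((t ^ 2 + 1).primeFactors.filter (fun p : ℕ => p ≠ 2)).card))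

/-- item stmt-Parity-15002 · crux · rank 4 · open · by planner
why it might fail: Equivalent (landed bookkeeping) to a power saving for Σ_{Q,Q′}(Q|Q′)S(h,QQ′) in near-balanced prime boxes (MixedBilinearBalanced): open — DFI 1997 bounds e(a·m̄/n) for FIXED a, here a = hν_Q moves with Q and χ_Q(Q′) twists it; a secondary term at structured h would bias it.
sources: doi:10.1007/s002220050135, doi:10.4064/aa-72-3-235-275, arXiv:math/9811185, doi:10.1016/j.aim.2018.01.026, doi:10.2307/2118527, doi:10.1093/imrn/rnr112
[crux] THE JUDGE'S ASK, TYPED (judge pass 2026-08-16T06:45Z, what_would_move_it: 'a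
reciprocity/lattice-point argument giving any nontrivial bound on J_θ for some θ < 1'): the
NEAR-BALANCED CORNER of the split-block Jacobi sum cancels. There is δ > 0 such that for all θ > 1/2
and μ ∈ [1−δ, 2−2θ) (hence θ < (1+δ)/2): Σ_{t≤x} Σ_{Q<Q′ primes ∣ t²+1, Q > x^θ, QQ′ ≤ x^{2−μ}}
(Q|Q′) = o(x) — J_θ (SplitBlockJacobi: ∀θ, o(x)) restricted to the pairs with product ≤ x^{2−μ} ≤
x^{1+δ}, i.e. cofactor m = (t²+1)/(QQ′) ≳ x^{1−δ} for t ≍ x: the ONE regime where line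
cofactor-root-discrepancy of stmt-Parity-11583 needs only ANY power saving. By the LANDED
bookkeeping — pair-side Fubini over the small roots of −1 mod QQ′ (lattice points; stub_pairForm),
expected part E = 4xΣ(Q|Q′)/(QQ′) = o(x) by quadratic reciprocity (Q|Q′) = χ_Q(Q′) + the
multiplicative large sieve (stub_expectedPart), small-cofactor peel (stub_smallCofactorTail),
Poisson on the root count (helpers RootCountFourier / Smoothing / Cells / Shell / Variation /
PoissonAsymptotics), corner implication tierWeylBound_of_mixedBilinearBalanced (MBB(δ₀) ⇒
TierWeylBound θ μ for μ ≥ 1 − δ₀/3) — it FOLLOWS with δ = δ₀/3 from ONE bilinear estim -/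
@[route_item "route-Parity-IsogenyRedei"]
def SplitBlockJacobiCorner : Prop :=
  ∃ δ : ℝ, 0 < δ ∧ ∀ θ μ : ℝ, 1 / 2 < θ → 1 - δ ≤ μ → μ < 2 - 2 * θ → (fun x : ℕ => ∑ t ∈ Finset.Icc 1 x, ∑ q ∈ ((t ^ 2 + 1).primeFactors ×ˢ (t ^ 2 + 1).primeFactors).filter (fun q : ℕ × ℕ => (x : ℝ) ^ θ < (q.1 : ℝ) ∧ q.1 < q.2 ∧ ((q.1 * q.2 : ℕ) : ℝ) ≤ (x : ℝ) ^ (2 - μ)), (jacobiSym (q.1 : ℤ) q.2 : ℝ)) =o[Filter.atTop] fun x : ℕ => (x : ℝ)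

/-- item stmt-Parity-14951 · crux (kind.auto-crux: conjecture-grade) · rank 9 · open · by planner
why it might fail: auto-crux — conjecture-grade statement (docstring avows it ('conjecture')); it is open, so it may simply be false
sources: FordMaynard2024PrimeSieves, arXiv:2505.00493, Hooley1967, BombieriAsymptoticSieve1976, Literature.Barriers.Parity.FordMaynardLowLevel
[support] REMAINDER — conjecture-grade, NOT attacked by this route; filed (rev 3, route-repair
2026-08-16) so that the slice feeds `closes` with honest accounting: the part of the k = 1, f = X²+1
Möbius tail with LARGE COFACTOR. There is η ∈ (0,1) such that for every ε > 0 some E = E(ε) gives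
|Σ_{n≤x} Σ_{d ∣ n²+1, d > x^{1−η}, (n²+1)/d > E} μ(d) log d| ≤ ε·x for all large x (typed: `E * d <
n ^ 2 + 1`). With e = (n²+1)/d this is the range E < e ≲ x^{1+η}: the LEVEL range (uniformity in the
cofactor modulus e, where root-class periodicity makes the cofactor polynomial linear in the class
variable) together with the balanced WINDOW e ≍ d ≍ x (thin set, c = 1/2: no Type-II range,
FordMaynardLowLevel) — the territory of GaussianFractions (RootLevelBeyondHalf / LogWindow /
CofactorLog, stmt-Parity-12215/12220/12217), SelmerPencil (SelmerParityLevel, TailGivenParity) and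
PolynomialMobius. This route contributes only the complementary bounded-cofactor range e ≤ E (via
PencilSelmerParitySW + PencilSelmerDictionary inside SliceFrame). Relation to
GaussianFractions.QuadraticMobiusTail (stmt-Parity-13616, the whole X²+1 slice): QuadraticMobiusTail
∧ (each bounded-e piece o(x)) ⇒ this statemen -/
@[route_item "route-Parity-IsogenyRedei"]
def GaussianTailLargeCofactor : Prop :=
  ∃ η : ℝ, 0 < η ∧ η < 1 ∧ ∀ ε : ℝ, 0 < ε → ∃ E : ℕ, ∀ᶠ x : ℕ in Filter.atTop, |∑ n ∈ Finset.Icc 1 x, ∑ d ∈ Nat.divisors (n ^ 2 + 1), (if (x : ℝ) ^ (1 - η) < (d : ℝ) ∧ E * d < n ^ 2 + 1 then (ArithmeticFunction.moebius d : ℝ) * Real.log (d : ℝ) else 0)| ≤ ε * (x : ℝ)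

/-- item stmt-Parity-14952 · crux · rank 9 · open · by planner
why it might fail: It is X_PM = BatemanHorn in Λ-form for every system except (1, X²+1): false iff BH fails for some non-Gaussian system — verbatim so over F_q[u] for inseparable f (Conrad–Conrad–Gross); no Type-I level < 1 decides it (Bombieri).
sources: BombieriAsymptoticSieve1976, arXiv:2008.09905, ConradConradGross2008, BatemanHorn1962, Literature.Barriers.Parity.FunctionFieldMobiusBias
[support] REMAINDER — conjecture-grade, NOT attacked by this route (rev 3, route-repair 2026-08-16):
the frame X_PM = PolyMobiusTail (stmt-Parity-0870) VERBATIM for every Bateman–Horn system (k, f)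
other than (1, X²+1) — extra hypothesis `k ≠ 1 ∨ ∃ i, f i ≠ X ^ 2 + 1`, conclusion
character-for-character the summand of PolyMobiusTail. It is BatemanHorn in Λ-form (modulo the
theorem-grade TypeIMainTerm / LambdaToCount) for all systems except the Gaussian one — the part of
the shared target this one-slice route never claimed — filed as a named item only so that SliceFrame
can conclude PolyMobiusTail BY NAME and the census sees exactly what is left (sibling slice routes
PolynomialMobius, CyclotomicTower (X⁴+1, Φ₈, Φ₁₂), CrossedSalie (X²+1, X²+3), GaussianFractions want
the same frame; a sibling's repair may re-want this decl verbatim or file its own complement).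
Closes iff X_PM closes off the Gaussian system; refuted iff BH fails for some non-Gaussian system
(verbatim so over 𝔽_q[u] for inseparable f, Conrad–Conrad–Gross). The case split `(literal (1,
![X²+1]) instance of X_PM) → PolyMobiusTailOffGaussian → PolyMobiusTail` is PROVED in the planner's
Sketch.lean (polyMobiusTail_of_insta -/
@[route_item "route-Parity-IsogenyRedei"]
def PolyMobiusTailOffGaussian : Prop :=
  ∀ (k : ℕ) (f : Fin k → Polynomial ℤ), Literature.NumberTheory.Sieve.IsBatemanHornSystem f → (k ≠ 1 ∨ ∃ i, f i ≠ Polynomial.X ^ 2 + 1) → ∃ η : ℝ, 0 < η ∧ η < 1 ∧ (fun x : ℕ => ∑ n ∈ Finset.Icc 1 x, ∑ d ∈ Fintype.piFinset (fun i => (((f i).eval (n : ℤ)).toNat).divisors), if (x : ℝ) ^ (1 - η) < ∏ i, (d i : ℝ) then ∏ i, ((ArithmeticFunction.moebius (d i) : ℝ) * Real.log (d i)) else 0) =o[Filter.atTop] fun x : ℕ => (x : ℝ)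

/-- item stmt-Parity-11585 · support · rank 4 · open · by planner
why it might fail: it is polynomial Chowla (ω-form) in APs for quadratics, open for every nonlinear f (Teräväinen 2024 Conj. 1.2; even infinitely many sign changes of λ(f(n)) is open for a general quadratic); inseparable 𝔽_q[u]-analogues are biased (CCG 2008).
sources: Teravainen2024, Chowla1965, ConradConradGross2008, Helfgott2003RootNumbers, BrowningSofosTeravainen2022
[crux] the OUTPUT of the engine on the 2-isogenous shape class: for every irreducible quadratic f ∈
ℤ[X] with positive leading coefficient and every q ≥ 1, a: Σ_{n≤x, n≡a (q)} (−1)^{ω(f(n))} = o(x)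
(every quadratic is in the class: 4a·f = (2aX+b)² − D gives y² = x(x² + (2an+b)x + a·f(n)) with b′ =
D constant; the sign picks up ∏_{p∣f(n)} ((2an+b)|p), which on squarefree values coprime to 2aD is
the Jacobi symbol ((2an+b)|f(n)), periodic in n by reciprocity since 4a·f(n) ≡ −D (mod 2an+b);
non-squarefree values go through the squarefree sieve of OmegaToMobiusAP). Chain (prose + supports):
SingleBlockMoments ∧ SplitBlockJacobi-type cancellation for every k ⇒ all moments of 2^{s_φ} along
every AP ⇒ (moment determinacy, support MomentsToParity) the law of s_φ as a parity-mixture of two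
Poonen–Rains-type laws with distinct moments ⇒ mixing weight 1/2 ⇒ via
PencilSelmerDictionary/Cassels this statement. ω-form of PolyMobiusAtom (stmt-Parity-0871) in APs at
degree 2; n²+1 neighbours stmt-Parity-0650/0615. [deps: SplitBlockJacobi, PencilSelmerDictionary]
[difficulty: open-problem] -/
@[route_item "route-Parity-IsogenyRedei"]
def QuadraticOmegaParity : Prop :=
  ∀ f : Polynomial ℤ, Irreducible f → f.natDegree = 2 → 0 < f.leadingCoeff → ∀ q a : ℕ, 0 < q → (fun x : ℕ => ∑ n ∈ (Finset.Icc 1 x).filter (fun n : ℕ => n ≡ a [MOD q]), (-1 : ℝ) ^ ArithmeticFunction.cardDistinctFactors ((f.eval (n : ℤ)).toNat)) =o[Filter.atTop] fun x : ℕ => (x : ℝ)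

/-- item stmt-Parity-0873 · support · rank 9 · closed · proved by Summit.Parity.BatemanHorn.Theorems.typeIMainTerm_proof (prover) · by planner
sources: BatemanHorn1962, BombieriAsymptoticSieve1976
[support] Type-I main term, theorem-grade: for every BH system f and η ∈ (0,1) there is C with
HasBatemanHornConst f C and (−1)^k ∑_{n≤x} ∑_{d_i | f_i(n), d_1⋯d_k ≤ x^{1−η}} ∏ μ(d_i) log d_i ~
C·x. Proof sketch: #{n ≤ x : d_i | f_i(n) ∀ i} = x ρ(d)/lcm(d) + O(ρ(d)) (period lcm(d) ≤ x^{1−η});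
the log-weighted singular series (−1)^k ∑_d ∏(μ(d_i) log d_i) ρ(d)/lcm(d) converges (ordered by the
cutoff) to the Bateman–Horn constant C(f) = ∏_p (1−1/p)^{−k}(1−ω(p)/p) by the prime ideal theorem
with error term in the splitting fields (Landau1903; BatemanHorn1962 §2; DavenportSchinzel1966; k =
1, f = X: −∑ μ(d) log d/d = 1). Named fact available:
Literature.NumberTheory.Sieve.exists_hasBatemanHornConst. Provable with substantial effort;
grounders may propose the needed Dedekind-zeta facts as Literature cites. -/
@[route_item "route-Parity-IsogenyRedei", crux]
def TypeIMainTerm : Prop :=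
  ∀ (k : ℕ) (f : Fin k → Polynomial ℤ), Literature.NumberTheory.Sieve.IsBatemanHornSystem f → ∀ η : ℝ, 0 < η → η < 1 → ∃ C : ℝ, 0 < C ∧ Literature.NumberTheory.Sieve.HasBatemanHornConst f C ∧ Asymptotics.IsEquivalent Filter.atTop (fun x : ℕ => (-1 : ℝ) ^ k * ∑ n ∈ Finset.Icc 1 x, ∑ d ∈ Fintype.piFinset (fun i => (((f i).eval (n : ℤ)).toNat).divisors), if ∏ i, (d i : ℝ) ≤ (x : ℝ) ^ (1 - η) then ∏ i, ((ArithmeticFunction.moebius (d i) : ℝ) * Real.log (d i)) else 0) (fun x : ℕ => C * (x : ℝ))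

/-- item stmt-Parity-0874 · support · rank 9 · closed · proved by Summit.Parity.BatemanHorn.LambdaToCount.lambdaToCount_proof (prover) · by planner
sources: BatemanHorn1962, IwaniecKowalski2004
[support] From Λ-weights to the count, theorem-grade: if ∑_{n≤x} ∏_i Λ(f_i(n)) ~ C·x with
HasBatemanHornConst f C then BatemanHornAsymptotic f (polyPrimeCount f x ~ C/(∏ deg f_i) · x/(log
x)^k). Partial summation (Λ(f_i(n)) = log f_i(n) = deg f_i · log n + O(1) at prime values) plus
negligibility of proper prime-power values f_i(n) = p^a, a ≥ 2: O(x^{1/2+ε}) — trivial for deg ≤ 2,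
Bombieri–Pila / Siegel integral points on y^a = f_i(x) for deg ≥ 3. C > 0 by
Literature.NumberTheory.Sieve.exists_hasBatemanHornConst. -/
@[route_item "route-Parity-IsogenyRedei", crux]
def LambdaToCount : Prop :=
  ∀ (k : ℕ) (f : Fin k → Polynomial ℤ), Literature.NumberTheory.Sieve.IsBatemanHornSystem f → ∀ C : ℝ, 0 < C → Literature.NumberTheory.Sieve.HasBatemanHornConst f C → Asymptotics.IsEquivalent Filter.atTop (fun x : ℕ => ∑ n ∈ Finset.Icc 1 x, ∏ i, ArithmeticFunction.vonMangoldt (((f i).eval (n : ℤ)).toNat)) (fun x : ℕ => C * (x : ℝ)) → Literature.NumberTheory.Sieve.BatemanHornAsymptotic f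

/-- item stmt-Parity-11586 · support · rank 9 · closed · proved by Summit.Parity.BatemanHorn.Theorems.pencilInvariants_proof @ b4f59f613f11 (prover) · by planner
sources: SilvermanAEC2009, arXiv:math/0408141
[support] invariants of the pencil E_t = ⟨0, 2t, 0, t²+1, 0⟩ over ℚ: c₄ = 16(t²−3), c₆ = 64t(t²+9),
Δ = −64(t²+1)² (identities in ℚ[t]; PROVED by `ring` in the planner's Sketch.lean, theorem
pencilInvariants_holds — a prover re-files it in Theorems). [difficulty: provable-now] -/
@[route_item "route-Parity-IsogenyRedei"]
def PencilInvariants : Prop :=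
  ∀ t : ℚ, (⟨0, 2 * t, 0, t ^ 2 + 1, 0⟩ : WeierstrassCurve ℚ).c₄ = 16 * (t ^ 2 - 3) ∧ (⟨0, 2 * t, 0, t ^ 2 + 1, 0⟩ : WeierstrassCurve ℚ).c₆ = 64 * t * (t ^ 2 + 9) ∧ (⟨0, 2 * t, 0, t ^ 2 + 1, 0⟩ : WeierstrassCurve ℚ).Δ = -(64 * (t ^ 2 + 1) ^ 2)

/-- item stmt-Parity-11587 · support · rank 9 · closed · proved by Summit.Parity.BatemanHorn.Theorems.pencilSplitFibres_proof (prover) · by planner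
sources: SilvermanAEC2009, Rohrlich1993Compositio, arXiv:math/0408141
[support] Mathlib-only local algebra (the Tate-algorithm half of PencilSelmerDictionary): for t ≥ 1
and every odd prime p, the model ⟨0, 2t, 0, t²+1, 0⟩ over ℚ_p has SPLIT multiplicative reduction
over ℤ_p when p ∣ t²+1 (v_p(c₄) = 0 as t² − 3 ≡ −4, so the model is minimal and multiplicative;
Mathlib's tangent polynomial c₄T² + a₁c₄T − (54b₆ − 3b₂b₄ + a₂c₄) = 16(t²−3)T² + 16t(t²+9) ≡ −64(T²
− 2t) (mod p) splits iff 2t is a square mod p, and (2t|p) = (2|p)(t|p) = +1 since p ≡ 1 (4) and t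
has order 4 mod p), and GOOD reduction when p ∤ t²+1 (v_p(Δ) = 0). Provable now with effort
(HasSplitMultiplicativeReduction / HasGoodReduction, IsMinimal via valuation of Δ, c₄). [difficulty:
L] -/
@[route_item "route-Parity-IsogenyRedei"]
def PencilSplitFibres : Prop :=
  ∀ t : ℕ, 1 ≤ t → ∀ (p : ℕ) [Fact p.Prime], p ≠ 2 → (p ∣ t ^ 2 + 1 → (⟨0, 2 * (t : ℚ_[p]), 0, (t : ℚ_[p]) ^ 2 + 1, 0⟩ : WeierstrassCurve ℚ_[p]).HasSplitMultiplicativeReduction ℤ_[p]) ∧ (¬ p ∣ t ^ 2 + 1 → (⟨0, 2 * (t : ℚ_[p]), 0, (t : ℚ_[p]) ^ 2 + 1, 0⟩ : WeierstrassCurve ℚ_[p]).HasGoodReduction ℤ_[p])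

/-- item stmt-Parity-11588 · support · rank 9 · closed · proved by Summit.Parity.BatemanHorn.Theorems.omegaToMobiusAP_proof (prover) · by planner
sources: Hooley1967, IwaniecInventiones1978, Teravainen2024
[support] junction to the frame's μ-currency: QuadraticOmegaParity → for every irreducible quadratic
f with positive leading coefficient and every q ≥ 1, a: Σ_{n≤x, n≡a (q)} μ(f(n)) = o(x)
(PolyMobiusAtom stmt-Parity-0871 at degree 2, along APs = the bounded-modulus root-class input of
the k = 1, deg-2 tail). Proof route: μ(f(n)) = Σ_{r² ∣ f(n)} μ(r)·(−1)^{ω(f(n))}·[f(n)/r²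
squarefree]… organised as the squarefree sieve: r ≤ x^δ — root classes mod r² are unions of APs,
apply the hypothesis with modulus q·r²; x^δ < r ≤ x^{1−δ} — the congruence count x·ρ(r²)/r² +
O(ρ(r²)) gives ≪ x^{1−δ+o(1)}; r > x^{1−δ} — f(n) = r²s with s ≤ x^{2δ+o(1)}, i.e. (2an+b)² − 4as·r²
= D, a Pell-type equation with O_D(log x) solutions n ≤ x per s (Estermann 1931 for n²+1). Provable
with effort. [difficulty: L] -/
@[route_item "route-Parity-IsogenyRedei"]
def OmegaToMobiusAP : Prop :=
  (∀ f : Polynomial ℤ, Irreducible f → f.natDegree = 2 → 0 < f.leadingCoeff → ∀ q a : ℕ, 0 < q → (fun x : ℕ => ∑ n ∈ (Finset.Icc 1 x).filter (fun n : ℕ => n ≡ a [MOD q]), (-1 : ℝ) ^ ArithmeticFunction.cardDistinctFactors ((f.eval (n : ℤ)).toNat)) =o[Filter.atTop] fun x : ℕ => (x : ℝ)) → ∀ f : Polynomial ℤ, Irreducible f → f.natDegree = 2 → 0 < f.leadingCoeff → ∀ q a : ℕ, 0 < q → (fun x : ℕ => ∑ n ∈ (Finset.Icc 1 x).filter (fun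 n : ℕ => n ≡ a [MOD q]), (ArithmeticFunction.moebius ((f.eval (n : ℤ)).toNat) : ℝ)) =o[Filter.atTop] fun x : ℕ => (x : ℝ)

/-- item stmt-Parity-14953 · support · rank 9 · closed · proved by Summit.Parity.BatemanHorn.Theorems.sliceFrame_proof @ 0daad2f096c9 (prover) · by planner
sources: Estermann1931Quadratfrei, Hooley1967, MontgomeryVaughan2007, BatemanHorn1962
[support] THE GLUE THAT PUTS THE SLICE INTO THE CONE OF `closes` (theorem-grade, provable with
effort; rev 3, route-repair 2026-08-16, unused-crux): PencilSelmerDictionary → PencilSelmerParitySW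
→ GaussianTailLargeCofactor → PolyMobiusTailOffGaussian → PolyMobiusTail. Proof route in three
steps. (i) PARITY TRANSFER + SQUAREFREE SIEVE WITH RATES: from the dictionary (−1)^{ω(n²+1)} =
−(−1)^{[n odd]}·w(n)·(−1)^{corank(E_n)} (w = ±1, 2^M-periodic), so on classes mod lcm(q, 2^{M+1})
the Selmer bound gives |Σ_{n≤y, n≡c (q)} (−1)^{ω(n²+1)}| ≪ y(log y)^{−A} for q ≤ (log y)^{A−1}; then
for each FIXED cofactor modulus e ≥ 1, A_e(y) := Σ_{n≤y, e∣n²+1} μ((n²+1)/e) ≪_e y/(log y)²: with m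
= (n²+1)/e write μ(m) = (−1)^{ω(m)}·Σ_{r²∣m} μ(r), note (−1)^{ω(m)} = ±(−1)^{ω(n²+1)} with the sign
constant on classes mod e·rad(e) (p ∣ gcd(e, m) ⟺ p^{v_p(e)+1} ∣ n²+1), and split r ≤ R := (log y)³
(parity bound on the root classes of e·rad(e)·r² ≤ (log y)^7), R < r ≤ y^{1−δ} (congruence count Σ_r
ρ(er²)(y/(er²) + 1) ≪ y·log R/R + y^{1−δ+o(1)}), r > y^{1−δ} (then n²+1 = (es)·r² with s ≤ 2y^{2δ}:
a negative Pell equation n² − (es)r² = −1 with O(log y) solutions n ≤ y for each s — Estermann 1931;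
Mathlib `Pell. -/
@[route_item "route-Parity-IsogenyRedei"]
def SliceFrame : Prop :=
  PencilSelmerDictionary → PencilSelmerParitySW → GaussianTailLargeCofactor → PolyMobiusTailOffGaussian → PolyMobiusTail

/-- item stmt-Parity-11589 · assembly · rank 1 · closed · proved by Summit.Parity.BatemanHorn.Theorems.isogenyRedei_assembly_proof @ a2447a268549 (prover) · by planner
sources: BatemanHorn1962, BombieriAsymptoticSieve1976, arXiv:math/0408141
[assembly] SplitBlockJacobi → PencilSelmerDictionary → QuadraticOmegaParity → PolyMobiusTail →
TypeIMainTerm → LambdaToCount → BatemanHorn (provable now from `closes` by discarding the first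
three premises). -/
@[route_item "route-Parity-IsogenyRedei"]
def Assembly : Prop :=
  SplitBlockJacobi → PencilSelmerDictionary → QuadraticOmegaParity → PolyMobiusTail → TypeIMainTerm → LambdaToCount → _root_.BatemanHorn

/-! D-0027 §2.1 — DECIDING THEOREM (planner-authored via `route open/edit --closes-file`; by planner-plancard-Parity-BatemanHorn-isogeny-d-04137cff-0 2026-08-15T18:25:27Z):
its hypotheses are this route's items and its conclusion the sub-problem Statement (glue_lint), and it elaborates with this file. -/

/-- D-0027 §2.1 deciding theorem of route IsogenyRedei: the three load-bearing frame items
`PolyMobiusTail` (target, = X_PM of route PolynomialMobius, stmt-Parity-0870), `TypeIMainTerm` (stmt-Parity-0873) and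
`LambdaToCount` (stmt-Parity-0874) imply the sub-problem statement `BatemanHorn`
(= `Literature.NumberTheory.Sieve.BatemanHornConjecture`). Same bookkeeping proof as PolynomialMobius.closes /
CyclotomicTower.closes (the three decls are verbatim the shared items): `∏ᵢ Λ(fᵢ(n)) = (−1)^k ∑_{dᵢ ∣ fᵢ(n)} ∏ᵢ μ(dᵢ) log dᵢ`
(Mathlib `ArithmeticFunction.sum_moebius_mul_log_eq` per coordinate, `Finset.prod_neg`, `Finset.prod_univ_sum`), the split of the
divisor sum at `∏ dᵢ ≤ x^{1−η}` versus `x^{1−η} < ∏ dᵢ`, then `IsEquivalent.add_isLittleO` and `LambdaToCount`.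
The slice cruxes (SplitBlockJacobi, PencilSelmerDictionary, QuadraticOmegaParity) and their supports feed the k = 1, degree-2,
bounded-modulus parity slice of `PolyMobiusTail` (prose link in the thesis); they are not hypotheses here. -/
@[closes "route-Parity-IsogenyRedei"] theorem closes (hTail : PolyMobiusTail) (hMain : TypeIMainTerm) (hCount : LambdaToCount) :
    _root_.BatemanHorn := by
  intro k f hf
  obtain ⟨η, hη0, hη1, hT⟩ := hTail k f hf
  obtain ⟨C, hC, hHas, hM⟩ := hMain k f hf η hη0 hη1
  refine hCount k f hf C hC hHas ?_
  -- Λ = -(μ · log) ∗ 1, coordinatewise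
  have hΛ : ∀ m : ℕ, ArithmeticFunction.vonMangoldt m
      = -∑ e ∈ m.divisors, ((ArithmeticFunction.moebius e : ℝ) * Real.log e) := by
    intro m
    have h := ArithmeticFunction.sum_moebius_mul_log_eq (n := m)
    simp only [ArithmeticFunction.log_apply] at h
    linarith
  -- step A: the product of the `Λ(fᵢ(n))` as a signed sum over divisor tuples
  have stepA : ∀ n : ℕ, (∏ i, ArithmeticFunction.vonMangoldt (((f i).eval (n : ℤ)).toNat))
      = (-1 : ℝ) ^ k * ∑ d ∈ Fintype.piFinset (fun i => (((f i).eval (n : ℤ)).toNat).divisors),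
          ∏ i, ((ArithmeticFunction.moebius (d i) : ℝ) * Real.log (d i)) := by
    intro n
    simp_rw [hΛ]
    rw [Finset.prod_neg, Finset.card_univ, Fintype.card_fin, Finset.prod_univ_sum]
  -- step B: the divisor sum splits into the Type-I range and the tail (complementary cut-offs)
  have stepB : ∀ x n : ℕ,
      (∑ d ∈ Fintype.piFinset (fun i => (((f i).eval (n : ℤ)).toNat).divisors),
          ∏ i, ((ArithmeticFunction.moebius (d i) : ℝ) * Real.log (d i)))
      = (∑ d ∈ Fintype.piFinset (fun i => (((f i).eval (n : ℤ)).toNat).divisors),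
          if ∏ i, (d i : ℝ) ≤ (x : ℝ) ^ (1 - η) then
            ∏ i, ((ArithmeticFunction.moebius (d i) : ℝ) * Real.log (d i)) else 0)
        + (∑ d ∈ Fintype.piFinset (fun i => (((f i).eval (n : ℤ)).toNat).divisors),
          if (x : ℝ) ^ (1 - η) < ∏ i, (d i : ℝ) then
            ∏ i, ((ArithmeticFunction.moebius (d i) : ℝ) * Real.log (d i)) else 0) := by
    intro x n
    rw [← Finset.sum_add_distrib]
    refine Finset.sum_congr rfl fun d _ => ?_
    by_cases h : ∏ i, (d i : ℝ) ≤ (x : ℝ) ^ (1 - η)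
    · rw [if_pos h, if_neg (not_lt.mpr h), add_zero]
    · rw [if_neg h, if_pos (not_le.mp h), zero_add]
  -- the tail, times `(-1)^k`, is `o(C·x)`
  have hB := (hT.const_mul_left ((-1 : ℝ) ^ k)).trans_isBigO
    (Asymptotics.isBigO_self_const_mul hC.ne' (fun x : ℕ => (x : ℝ)) Filter.atTop)
  refine (hM.add_isLittleO hB).congr_left (Filter.Eventually.of_forall fun x => ?_)
  simp only [Pi.add_apply]
  rw [← mul_add, ← Finset.sum_add_distrib, Finset.mul_sum]
  refine Finset.sum_congr rfl fun n _ => ?_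
  rw [stepA n, stepB x n]

end Summit.Parity.BatemanHorn.Theses.IsogenyRedei
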